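import Summits.CriticalPhenomena.PercolationContinuityZ3.Theorems.PercNearOneGluingAdditiveGluingGoodStep24Main
import Summits.CriticalPhenomena.PercolationContinuityZ3.Theorems.PercNearOneGluingAdditiveGluingBlockGrowth
import HarnessLib

/-! # Crux `PercNearOneGluing.AdditiveGluing` (stmt-CriticalPhenomena-4576): **the crux follows from the v7 CONE statement** (assembly)

Lead c5 (line `peel`, skeleton v7, whole-block route); lands `--supports stmt-CriticalPhenomena-4576`.
No definitions, no named facts.  CONDITIONAL result: every theorem takes the v7 cone statement `hcone7` (spelled out in full).

`hcone7`: for a weighting `u`, relays `A ∋ b`, a block `S` of non-relays and a minimiser `a₀ ∈ A` of `μ_u(· ↔ b)` over `A`,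
block goodness of `S` at `a₀` with the worst selection,
`μ_u(a₀↔b) + μ_u(a₀↮b, a₀↔S, S↔b) ≤ μ_u(S↔b) + Σ_{W ∩ A = ∅} μ_u(K_S = W) · min_{a ∈ A} μ_u(a ↔ b off W)`,
GIVEN the same block goodness for every weighting with strictly fewer positive-degree vertices (every `A', S', b'`, every
minimiser `d'`).  The assembly is the landed cone assembly (`coneLine_goodStep`, `coneLine_good_all`,
`coneLine_additiveGluing_of` of `…ConeAssembly`) re-run with one change: block goodness in the star-killed weighting `K` is no
longer produced by the cone chain `coneLine_blockGood` (badness, `4 ≤ A.card`) but read off `hcone7`, whose smaller-weighting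
premise is discharged once and for all by a strong induction on the number of positive-degree vertices (`cone7_blockGood_all`).
Then: `cone7_goodStep` (`goodStep24_main` + un-gluing H3 + worst selection ≤ any selection), `cone7_good_all` (strong induction,
base `stub_goodBase stub_lemma5AnyRelay`), `cone7_additiveGluing_of` (KN level sets), and the registered handle
`stub_cone7Assembly_c5 : cone7 → AdditiveGluing` (statement unfolded).
[cite: KozmaNitzan2024, §3.2 Definition p. 12, Thms 4–5 pp. 12–14, Lemma 5 p. 13, §3.1 Remark p. 5]
-/

namespace Summit.CriticalPhenomena.PercolationContinuityZ3.Theorems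

open MeasureTheory Set
open Literature.Probability.LatticeModels (prodBernoulli)
open Literature.Probability.Percolation (BondConfig openConn openConnIn openGraph openCluster)
open scoped BigOperators Classical

noncomputable section

/-- **Block goodness of every block at a minimiser, in every weighting**, from the v7 cone statement: strong induction on the
number of positive-degree vertices, each level being `hcone7` fed with the induction hypothesis.
[cite: KozmaNitzan2024, §3.2 pp. 12–14] -/
theorem cone7_blockGood_all
    (hcone7 : ∀ (n : ℕ) (u : Sym2 (Fin n) → unitInterval) (A S : Finset (Fin n)) (b a₀ : Fin n) (hb : b ∈ A),
      Disjoint S A → a₀ ∈ A →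
      (∀ a ∈ A, (prodBernoulli u).real (openConn a₀ b) ≤ (prodBernoulli u).real (openConn a b)) →
      (∀ w' : Sym2 (Fin n) → unitInterval,
        (Finset.univ.filter (fun v : Fin n => ∃ y : Fin n, 0 < (w' s(y, v) : ℝ))).card
          < (Finset.univ.filter (fun v : Fin n => ∃ y : Fin n, 0 < (u s(y, v) : ℝ))).card →
        ∀ (A' S' : Finset (Fin n)) (b' d' : Fin n) (hb' : b' ∈ A'), Disjoint S' A' → d' ∈ A' →
        (∀ a ∈ A', (prodBernoulli w').real (openConn d' b') ≤ (prodBernoulli w').real (openConn a b')) →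
        (prodBernoulli w').real (openConn d' b')
          + (prodBernoulli w').real
              ((openConn d' b')ᶜ ∩ (⋃ v ∈ S', openConn d' v) ∩ (⋃ v ∈ S', openConn v b'))
        ≤ (prodBernoulli w').real (⋃ v ∈ S', openConn v b')
          + (∑ W ∈ (Finset.univ : Finset (Finset (Fin n))).filter (fun W => Disjoint W A'),
              (prodBernoulli w').real
                  {ω : BondConfig (Fin n) | ∀ z : Fin n, (z ∈ W ↔ ω ∈ ⋃ v ∈ S', openConn v z)}
                * A'.inf' ⟨b', hb'⟩ (fun a => (prodBernoulli w').real (openConnIn ((W : Set (Fin n))ᶜ) a b')))) →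
      (prodBernoulli u).real (openConn a₀ b)
          + (prodBernoulli u).real
              ((openConn a₀ b)ᶜ ∩ (⋃ v ∈ S, openConn a₀ v) ∩ (⋃ v ∈ S, openConn v b))
        ≤ (prodBernoulli u).real (⋃ v ∈ S, openConn v b)
          + (∑ W ∈ (Finset.univ : Finset (Finset (Fin n))).filter (fun W => Disjoint W A),
              (prodBernoulli u).real
                  {ω : BondConfig (Fin n) | ∀ z : Fin n, (z ∈ W ↔ ω ∈ ⋃ v ∈ S, openConn v z)}
                * A.inf' ⟨b, hb⟩ (fun a => (prodBernoulli u).real (openConnIn ((W : Set (Fin n))ᶜ) a b))))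
    (n : ℕ) :
    ∀ (w : Sym2 (Fin n) → unitInterval) (A S : Finset (Fin n)) (b d : Fin n) (hb : b ∈ A),
      Disjoint S A → d ∈ A →
      (∀ a ∈ A, (prodBernoulli w).real (openConn d b) ≤ (prodBernoulli w).real (openConn a b)) →
      (prodBernoulli w).real (openConn d b)
          + (prodBernoulli w).real
              ((openConn d b)ᶜ ∩ (⋃ v ∈ S, openConn d v) ∩ (⋃ v ∈ S, openConn v b))
        ≤ (prodBernoulli w).real (⋃ v ∈ S, openConn v b)
          + (∑ W ∈ (Finset.univ : Finset (Finset (Fin n))).filter (fun W => Disjoint W A),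
              (prodBernoulli w).real
                  {ω : BondConfig (Fin n) | ∀ z : Fin n, (z ∈ W ↔ ω ∈ ⋃ v ∈ S, openConn v z)}
                * A.inf' ⟨b, hb⟩ (fun a => (prodBernoulli w).real (openConnIn ((W : Set (Fin n))ᶜ) a b))) := by
  suffices h : ∀ (m : ℕ) (w : Sym2 (Fin n) → unitInterval),
      (Finset.univ.filter (fun v : Fin n => ∃ y : Fin n, 0 < (w s(y, v) : ℝ))).card = m →
      ∀ (A S : Finset (Fin n)) (b d : Fin n) (hb : b ∈ A), Disjoint S A → d ∈ A →
      (∀ a ∈ A, (prodBernoulli w).real (openConn d b) ≤ (prodBernoulli w).real (openConn a b)) →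
      (prodBernoulli w).real (openConn d b)
          + (prodBernoulli w).real
              ((openConn d b)ᶜ ∩ (⋃ v ∈ S, openConn d v) ∩ (⋃ v ∈ S, openConn v b))
        ≤ (prodBernoulli w).real (⋃ v ∈ S, openConn v b)
          + (∑ W ∈ (Finset.univ : Finset (Finset (Fin n))).filter (fun W => Disjoint W A),
              (prodBernoulli w).real
                  {ω : BondConfig (Fin n) | ∀ z : Fin n, (z ∈ W ↔ ω ∈ ⋃ v ∈ S, openConn v z)}
                * A.inf' ⟨b, hb⟩ (fun a => (prodBernoulli w).real (openConnIn ((W : Set (Fin n))ᶜ) a b))) by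
    intro w A S b d hb hSA hd hmin
    exact h _ w rfl A S b d hb hSA hd hmin
  intro m
  induction m using Nat.strong_induction_on with
  | _ m ih =>
    intro w hm A S b d hb hSA hd hmin
    refine hcone7 n w A S b d hb hSA hd hmin ?_
    intro w' hw' A' S' b' d' hb' hS'A' hd' hmin'
    exact ih _ (hm ▸ hw') w' rfl A' S' b' d' hb' hS'A' hd' hmin'

/-- **The inductive step `stub_goodStep` (verbatim) from the v7 cone statement.**  `goodStep24_main`; un-gluing (H3); the residue
is block goodness of the layer block in the star-killed weighting `K` (`cone7_blockGood_all`), whose worst selection is below any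
selection termwise. [cite: KozmaNitzan2024, §3.2 pp. 12–14, §3.1 Remark p. 5] -/
theorem cone7_goodStep
    (hcone7 : ∀ (n : ℕ) (u : Sym2 (Fin n) → unitInterval) (A S : Finset (Fin n)) (b a₀ : Fin n) (hb : b ∈ A),
      Disjoint S A → a₀ ∈ A →
      (∀ a ∈ A, (prodBernoulli u).real (openConn a₀ b) ≤ (prodBernoulli u).real (openConn a b)) →
      (∀ w' : Sym2 (Fin n) → unitInterval,
        (Finset.univ.filter (fun v : Fin n => ∃ y : Fin n, 0 < (w' s(y, v) : ℝ))).card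
          < (Finset.univ.filter (fun v : Fin n => ∃ y : Fin n, 0 < (u s(y, v) : ℝ))).card →
        ∀ (A' S' : Finset (Fin n)) (b' d' : Fin n) (hb' : b' ∈ A'), Disjoint S' A' → d' ∈ A' →
        (∀ a ∈ A', (prodBernoulli w').real (openConn d' b') ≤ (prodBernoulli w').real (openConn a b')) →
        (prodBernoulli w').real (openConn d' b')
          + (prodBernoulli w').real
              ((openConn d' b')ᶜ ∩ (⋃ v ∈ S', openConn d' v) ∩ (⋃ v ∈ S', openConn v b'))
        ≤ (prodBernoulli w').real (⋃ v ∈ S', openConn v b')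
          + (∑ W ∈ (Finset.univ : Finset (Finset (Fin n))).filter (fun W => Disjoint W A'),
              (prodBernoulli w').real
                  {ω : BondConfig (Fin n) | ∀ z : Fin n, (z ∈ W ↔ ω ∈ ⋃ v ∈ S', openConn v z)}
                * A'.inf' ⟨b', hb'⟩ (fun a => (prodBernoulli w').real (openConnIn ((W : Set (Fin n))ᶜ) a b')))) →
      (prodBernoulli u).real (openConn a₀ b)
          + (prodBernoulli u).real
              ((openConn a₀ b)ᶜ ∩ (⋃ v ∈ S, openConn a₀ v) ∩ (⋃ v ∈ S, openConn v b))
        ≤ (prodBernoulli u).real (⋃ v ∈ S, openConn v b)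
          + (∑ W ∈ (Finset.univ : Finset (Finset (Fin n))).filter (fun W => Disjoint W A),
              (prodBernoulli u).real
                  {ω : BondConfig (Fin n) | ∀ z : Fin n, (z ∈ W ↔ ω ∈ ⋃ v ∈ S, openConn v z)}
                * A.inf' ⟨b, hb⟩ (fun a => (prodBernoulli u).real (openConnIn ((W : Set (Fin n))ᶜ) a b)))) :
    ∀ (n : ℕ) (w : Sym2 (Fin n) → unitInterval) (A : Finset (Fin n)) (o b : Fin n),
      b ∈ A → o ∉ A →
      (∃ y : Fin n, y ∉ A ∧ y ≠ o ∧ (w s(o, y) : ℝ) ≠ 0) →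
      (∀ w' : Sym2 (Fin n) → unitInterval,
        (Finset.univ.filter (fun v : Fin n => ∃ u : Fin n, 0 < (w' s(u, v) : ℝ))).card
          < (Finset.univ.filter (fun v : Fin n => ∃ u : Fin n, 0 < (w s(u, v) : ℝ))).card →
        ∀ (A' : Finset (Fin n)) (o' b' : Fin n), b' ∈ A' → o' ∉ A' →
        ∀ (t : ℝ) (sel : Finset (Fin n) → Fin n), (∀ W, sel W ∈ A') →
          (∀ a ∈ A', 1 - t ≤ (prodBernoulli w').real (openConn a b')) →
          (prodBernoulli w').real ((⋃ a ∈ A', openConn o' a) ∩ (openConn o' b')ᶜ)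
            + ∑ W ∈ (Finset.univ : Finset (Finset (Fin n))).filter (fun W => o' ∈ W ∧ Disjoint W A'),
                (prodBernoulli w').real {ω : BondConfig (Fin n) | openCluster ω o' = (W : Set (Fin n))}
                  * (prodBernoulli w').real (openConnIn ((W : Set (Fin n))ᶜ) (sel W) b')ᶜ
            ≤ t) →
      ∀ (t : ℝ) (sel : Finset (Fin n) → Fin n), (∀ W, sel W ∈ A) →
        (∀ a ∈ A, 1 - t ≤ (prodBernoulli w).real (openConn a b)) →
        (prodBernoulli w).real ((⋃ a ∈ A, openConn o a) ∩ (openConn o b)ᶜ)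
          + ∑ W ∈ (Finset.univ : Finset (Finset (Fin n))).filter (fun W => o ∈ W ∧ Disjoint W A),
              (prodBernoulli w).real {ω : BondConfig (Fin n) | openCluster ω o = (W : Set (Fin n))}
                * (prodBernoulli w).real (openConnIn ((W : Set (Fin n))ᶜ) (sel W) b)ᶜ
          ≤ t := by
  intro n w A o b hb ho hlow IH
  refine goodStep24_main n w A o b hb ho hlow IH ?_
  intro S sel a₀ _h2 _hoS hSA _hSw hsel ha₀ hmin _hbad
  set K : Sym2 (Fin n) → unitInterval := fun e => if o ∈ e then (0 : unitInterval) else w e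
  rw [blockGrowth_glue_real_openConn, blockGrowth_glue_real_iUnion K S b]
  simp only [blockGrowth_glue_real_pocket K S]
  -- block goodness of `S` at the minimiser `a₀` in `K`, worst selection
  have hS := cone7_blockGood_all hcone7 n K A S b a₀ hb hSA ha₀ hmin
  -- the worst selection is below the selection `W' ↦ sel (insert o W')` termwise
  have hsel_le : (∑ W ∈ (Finset.univ : Finset (Finset (Fin n))).filter (fun W => Disjoint W A),
          (prodBernoulli K).real
              {ω : BondConfig (Fin n) | ∀ z : Fin n, (z ∈ W ↔ ω ∈ ⋃ v ∈ S, openConn v z)}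
            * A.inf' ⟨b, hb⟩ (fun a => (prodBernoulli K).real (openConnIn ((W : Set (Fin n))ᶜ) a b)))
      ≤ ∑ W ∈ (Finset.univ : Finset (Finset (Fin n))).filter (fun W => Disjoint W A),
          (prodBernoulli K).real {ω : BondConfig (Fin n) | ∀ z : Fin n, (z ∈ W ↔ ω ∈ ⋃ v ∈ S, openConn v z)}
            * (prodBernoulli K).real (openConnIn ((W : Set (Fin n))ᶜ) (sel (insert o W)) b) := by
    refine Finset.sum_le_sum fun W _ => mul_le_mul_of_nonneg_left ?_ measureReal_nonneg
    exact Finset.inf'_le _ (hsel (insert o W))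
  linarith

/-- **Every quadruple is good** from the v7 cone statement: strong induction on the number of positive-degree vertices; base = the
landed `stub_goodBase` (with `stub_lemma5AnyRelay`), step = `cone7_goodStep`. [cite: KozmaNitzan2024, §3.2 Lemma 5 p. 13, Thms 4–5 pp. 12–14] -/
theorem cone7_good_all
    (hcone7 : ∀ (n : ℕ) (u : Sym2 (Fin n) → unitInterval) (A S : Finset (Fin n)) (b a₀ : Fin n) (hb : b ∈ A),
      Disjoint S A → a₀ ∈ A →
      (∀ a ∈ A, (prodBernoulli u).real (openConn a₀ b) ≤ (prodBernoulli u).real (openConn a b)) →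
      (∀ w' : Sym2 (Fin n) → unitInterval,
        (Finset.univ.filter (fun v : Fin n => ∃ y : Fin n, 0 < (w' s(y, v) : ℝ))).card
          < (Finset.univ.filter (fun v : Fin n => ∃ y : Fin n, 0 < (u s(y, v) : ℝ))).card →
        ∀ (A' S' : Finset (Fin n)) (b' d' : Fin n) (hb' : b' ∈ A'), Disjoint S' A' → d' ∈ A' →
        (∀ a ∈ A', (prodBernoulli w').real (openConn d' b') ≤ (prodBernoulli w').real (openConn a b')) →
        (prodBernoulli w').real (openConn d' b')
          + (prodBernoulli w').real
              ((openConn d' b')ᶜ ∩ (⋃ v ∈ S', openConn d' v) ∩ (⋃ v ∈ S', openConn v b'))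
        ≤ (prodBernoulli w').real (⋃ v ∈ S', openConn v b')
          + (∑ W ∈ (Finset.univ : Finset (Finset (Fin n))).filter (fun W => Disjoint W A'),
              (prodBernoulli w').real
                  {ω : BondConfig (Fin n) | ∀ z : Fin n, (z ∈ W ↔ ω ∈ ⋃ v ∈ S', openConn v z)}
                * A'.inf' ⟨b', hb'⟩ (fun a => (prodBernoulli w').real (openConnIn ((W : Set (Fin n))ᶜ) a b')))) →
      (prodBernoulli u).real (openConn a₀ b)
          + (prodBernoulli u).real
              ((openConn a₀ b)ᶜ ∩ (⋃ v ∈ S, openConn a₀ v) ∩ (⋃ v ∈ S, openConn v b))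
        ≤ (prodBernoulli u).real (⋃ v ∈ S, openConn v b)
          + (∑ W ∈ (Finset.univ : Finset (Finset (Fin n))).filter (fun W => Disjoint W A),
              (prodBernoulli u).real
                  {ω : BondConfig (Fin n) | ∀ z : Fin n, (z ∈ W ↔ ω ∈ ⋃ v ∈ S, openConn v z)}
                * A.inf' ⟨b, hb⟩ (fun a => (prodBernoulli u).real (openConnIn ((W : Set (Fin n))ᶜ) a b))))
    (n : ℕ) :
    ∀ (w : Sym2 (Fin n) → unitInterval) (A : Finset (Fin n)) (o b : Fin n),
      b ∈ A → o ∉ A →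
      ∀ (t : ℝ) (sel : Finset (Fin n) → Fin n), (∀ W, sel W ∈ A) →
        (∀ a ∈ A, 1 - t ≤ (prodBernoulli w).real (openConn a b)) →
        (prodBernoulli w).real ((⋃ a ∈ A, openConn o a) ∩ (openConn o b)ᶜ)
          + ∑ W ∈ (Finset.univ : Finset (Finset (Fin n))).filter (fun W => o ∈ W ∧ Disjoint W A),
              (prodBernoulli w).real {ω : BondConfig (Fin n) | openCluster ω o = (W : Set (Fin n))}
                * (prodBernoulli w).real (openConnIn ((W : Set (Fin n))ᶜ) (sel W) b)ᶜ
          ≤ t := by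
  suffices h : ∀ (k : ℕ) (w : Sym2 (Fin n) → unitInterval),
      (Finset.univ.filter (fun v : Fin n => ∃ u : Fin n, 0 < (w s(u, v) : ℝ))).card = k →
      ∀ (A : Finset (Fin n)) (o b : Fin n),
      b ∈ A → o ∉ A →
      ∀ (t : ℝ) (sel : Finset (Fin n) → Fin n), (∀ W, sel W ∈ A) →
        (∀ a ∈ A, 1 - t ≤ (prodBernoulli w).real (openConn a b)) →
        (prodBernoulli w).real ((⋃ a ∈ A, openConn o a) ∩ (openConn o b)ᶜ)
          + ∑ W ∈ (Finset.univ : Finset (Finset (Fin n))).filter (fun W => o ∈ W ∧ Disjoint W A),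
              (prodBernoulli w).real {ω : BondConfig (Fin n) | openCluster ω o = (W : Set (Fin n))}
                * (prodBernoulli w).real (openConnIn ((W : Set (Fin n))ᶜ) (sel W) b)ᶜ
          ≤ t by
    intro w A o b hb ho
    exact h _ w rfl A o b hb ho
  intro k
  induction k using Nat.strong_induction_on with
  | _ k ih =>
    intro w hk A o b hb ho
    by_cases hiso : ∀ y : Fin n, y ∉ A → y ≠ o → (w s(o, y) : ℝ) = 0
    · exact stub_goodBase stub_lemma5AnyRelay n w A o b hb ho hiso
    · push Not at hiso
      refine cone7_goodStep hcone7 n w A o b hb ho hiso ?_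
      intro w' hw' A' o' b' hb' ho'
      exact ih _ (hk ▸ hw') w' rfl A' o' b' hb' ho'

/-- **`AdditiveGluing` (its statement, verbatim) from the v7 cone statement**: KN's level-set normal form (the relay set is the
level set `{x | 1 - t ≤ μ(x ↔ b)} ∋ b`, the selection is constantly `b`). [cite: KozmaNitzan2024, §3.2 Thm 4 pp. 12–14] -/
theorem cone7_additiveGluing_of
    (hcone7 : ∀ (n : ℕ) (u : Sym2 (Fin n) → unitInterval) (A S : Finset (Fin n)) (b a₀ : Fin n) (hb : b ∈ A),
      Disjoint S A → a₀ ∈ A →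
      (∀ a ∈ A, (prodBernoulli u).real (openConn a₀ b) ≤ (prodBernoulli u).real (openConn a b)) →
      (∀ w' : Sym2 (Fin n) → unitInterval,
        (Finset.univ.filter (fun v : Fin n => ∃ y : Fin n, 0 < (w' s(y, v) : ℝ))).card
          < (Finset.univ.filter (fun v : Fin n => ∃ y : Fin n, 0 < (u s(y, v) : ℝ))).card →
        ∀ (A' S' : Finset (Fin n)) (b' d' : Fin n) (hb' : b' ∈ A'), Disjoint S' A' → d' ∈ A' →
        (∀ a ∈ A', (prodBernoulli w').real (openConn d' b') ≤ (prodBernoulli w').real (openConn a b')) →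
        (prodBernoulli w').real (openConn d' b')
          + (prodBernoulli w').real
              ((openConn d' b')ᶜ ∩ (⋃ v ∈ S', openConn d' v) ∩ (⋃ v ∈ S', openConn v b'))
        ≤ (prodBernoulli w').real (⋃ v ∈ S', openConn v b')
          + (∑ W ∈ (Finset.univ : Finset (Finset (Fin n))).filter (fun W => Disjoint W A'),
              (prodBernoulli w').real
                  {ω : BondConfig (Fin n) | ∀ z : Fin n, (z ∈ W ↔ ω ∈ ⋃ v ∈ S', openConn v z)}
                * A'.inf' ⟨b', hb'⟩ (fun a => (prodBernoulli w').real (openConnIn ((W : Set (Fin n))ᶜ) a b')))) →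
      (prodBernoulli u).real (openConn a₀ b)
          + (prodBernoulli u).real
              ((openConn a₀ b)ᶜ ∩ (⋃ v ∈ S, openConn a₀ v) ∩ (⋃ v ∈ S, openConn v b))
        ≤ (prodBernoulli u).real (⋃ v ∈ S, openConn v b)
          + (∑ W ∈ (Finset.univ : Finset (Finset (Fin n))).filter (fun W => Disjoint W A),
              (prodBernoulli u).real
                  {ω : BondConfig (Fin n) | ∀ z : Fin n, (z ∈ W ↔ ω ∈ ⋃ v ∈ S, openConn v z)}
                * A.inf' ⟨b, hb⟩ (fun a => (prodBernoulli u).real (openConnIn ((W : Set (Fin n))ᶜ) a b)))) :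
    ∀ (n : ℕ) (w : Sym2 (Fin n) → unitInterval) (A : Finset (Fin n)) (o b : Fin n) (t : ℝ), 0 ≤ t →
      (∀ a ∈ A, 1 - t ≤ (prodBernoulli w).real (openConn a b)) →
      (prodBernoulli w).real (⋃ a ∈ A, openConn o a) - t ≤ (prodBernoulli w).real (openConn o b) := by
  intro n w A o b t ht hA
  have hU1 : (prodBernoulli w).real (⋃ a ∈ A, (openConn o a : Set (BondConfig (Fin n)))) ≤ 1 :=
    measureReal_le_one
  have hob0 : 0 ≤ (prodBernoulli w).real (openConn o b : Set (BondConfig (Fin n))) := measureReal_nonneg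
  by_cases ht1 : 1 ≤ t
  · linarith
  push Not at ht1
  have hbb : (prodBernoulli w).real (openConn b b : Set (BondConfig (Fin n))) = 1 := by
    have h : (openConn b b : Set (BondConfig (Fin n))) = Set.univ :=
      Set.eq_univ_of_forall fun ω => (SimpleGraph.Reachable.refl b : (openGraph ω).Reachable b b)
    rw [h, probReal_univ]
  have hbA' : b ∈ Finset.univ.filter (fun x : Fin n => 1 - t ≤ (prodBernoulli w).real (openConn x b)) := by
    rw [Finset.mem_filter]
    refine ⟨Finset.mem_univ _, ?_⟩
    rw [hbb]
    linarith
  have hAA' : ∀ a ∈ A, a ∈ Finset.univ.filter (fun x : Fin n => 1 - t ≤ (prodBernoulli w).real (openConn x b)) :=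
    fun a ha => by
      rw [Finset.mem_filter]
      exact ⟨Finset.mem_univ _, hA a ha⟩
  have hmemA' : ∀ x ∈ Finset.univ.filter (fun x : Fin n => 1 - t ≤ (prodBernoulli w).real (openConn x b)),
      1 - t ≤ (prodBernoulli w).real (openConn x b) := fun x hx => by
    rw [Finset.mem_filter] at hx
    exact hx.2
  by_cases ho : o ∈ Finset.univ.filter (fun x : Fin n => 1 - t ≤ (prodBernoulli w).real (openConn x b))
  · have := hmemA' o ho
    linarith
  have hgood := cone7_good_all hcone7 n w
    (Finset.univ.filter (fun x : Fin n => 1 - t ≤ (prodBernoulli w).real (openConn x b))) o b hbA' ho t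
    (fun _ => b) (fun _ => hbA') hmemA'
  have hsum : 0 ≤ ∑ W ∈ (Finset.univ : Finset (Finset (Fin n))).filter (fun W => o ∈ W ∧
      Disjoint W (Finset.univ.filter (fun x : Fin n => 1 - t ≤ (prodBernoulli w).real (openConn x b)))),
        (prodBernoulli w).real {ω : BondConfig (Fin n) | openCluster ω o = (W : Set (Fin n))}
          * (prodBernoulli w).real (openConnIn ((W : Set (Fin n))ᶜ) ((fun _ => b) W) b)ᶜ :=
    Finset.sum_nonneg fun W _ => mul_nonneg measureReal_nonneg measureReal_nonneg
  have hlive : (prodBernoulli w).real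
      ((⋃ a ∈ Finset.univ.filter (fun x : Fin n => 1 - t ≤ (prodBernoulli w).real (openConn x b)),
        (openConn o a : Set (BondConfig (Fin n)))) ∩ (openConn o b)ᶜ) ≤ t := by
    linarith
  have hsub : (⋃ a ∈ A, (openConn o a : Set (BondConfig (Fin n)))) ⊆
      ((⋃ a ∈ Finset.univ.filter (fun x : Fin n => 1 - t ≤ (prodBernoulli w).real (openConn x b)),
        (openConn o a : Set (BondConfig (Fin n)))) ∩ (openConn o b)ᶜ) ∪ openConn o b := by
    intro ω hω
    by_cases hb : ω ∈ openConn o b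
    · exact Or.inr hb
    · refine Or.inl ⟨?_, hb⟩
      simp only [Set.mem_iUnion] at hω ⊢
      obtain ⟨a, ha, hωa⟩ := hω
      exact ⟨a, hAA' a ha, hωa⟩
  have hfin := (measureReal_mono (μ := prodBernoulli w) hsub).trans (measureReal_union_le _ _)
  linarith

/-- Registered stub `stub_cone7Assembly_c5` of crux stmt-CriticalPhenomena-4576 (lead c5, line `peel`, skeleton v7, whole-block
route): **the v7 cone statement implies additive gluing** (fully spelled statement). [cite: KozmaNitzan2024, §3.2 pp. 12–14] -/
theorem stub_cone7Assembly_c5 : (∀ (n : ℕ) (u : Sym2 (Fin n) → unitInterval) (A S : Finset (Fin n)) (b a₀ : Fin n) (hb : b ∈ A),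
        Disjoint S A → a₀ ∈ A →
        (∀ a ∈ A, (prodBernoulli u).real (openConn a₀ b) ≤ (prodBernoulli u).real (openConn a b)) →
        (∀ w' : Sym2 (Fin n) → unitInterval,
          (Finset.univ.filter (fun v : Fin n => ∃ y : Fin n, 0 < (w' s(y, v) : ℝ))).card
            < (Finset.univ.filter (fun v : Fin n => ∃ y : Fin n, 0 < (u s(y, v) : ℝ))).card →
          ∀ (A' S' : Finset (Fin n)) (b' d' : Fin n) (hb' : b' ∈ A'), Disjoint S' A' → d' ∈ A' →
          (∀ a ∈ A', (prodBernoulli w').real (openConn d' b') ≤ (prodBernoulli w').real (openConn a b')) →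
          (prodBernoulli w').real (openConn d' b')
            + (prodBernoulli w').real
                ((openConn d' b')ᶜ ∩ (⋃ v ∈ S', openConn d' v) ∩ (⋃ v ∈ S', openConn v b'))
          ≤ (prodBernoulli w').real (⋃ v ∈ S', openConn v b')
            + (∑ W ∈ (Finset.univ : Finset (Finset (Fin n))).filter (fun W => Disjoint W A'),
                (prodBernoulli w').real
                    {ω : BondConfig (Fin n) | ∀ z : Fin n, (z ∈ W ↔ ω ∈ ⋃ v ∈ S', openConn v z)}
                  * A'.inf' ⟨b', hb'⟩ (fun a => (prodBernoulli w').real (openConnIn ((W : Set (Fin n))ᶜ) a b')))) →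
        (prodBernoulli u).real (openConn a₀ b)
            + (prodBernoulli u).real
                ((openConn a₀ b)ᶜ ∩ (⋃ v ∈ S, openConn a₀ v) ∩ (⋃ v ∈ S, openConn v b))
          ≤ (prodBernoulli u).real (⋃ v ∈ S, openConn v b)
            + (∑ W ∈ (Finset.univ : Finset (Finset (Fin n))).filter (fun W => Disjoint W A),
                (prodBernoulli u).real
                    {ω : BondConfig (Fin n) | ∀ z : Fin n, (z ∈ W ↔ ω ∈ ⋃ v ∈ S, openConn v z)}
                  * A.inf' ⟨b, hb⟩ (fun a => (prodBernoulli u).real (openConnIn ((W : Set (Fin n))ᶜ) a b)))) →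
      ∀ (n : ℕ) (w : Sym2 (Fin n) → unitInterval) (A : Finset (Fin n)) (o b : Fin n) (t : ℝ), 0 ≤ t →
      (∀ a ∈ A, 1 - t ≤ (prodBernoulli w).real (openConn a b)) →
      (prodBernoulli w).real (⋃ a ∈ A, openConn o a) - t ≤ (prodBernoulli w).real (openConn o b) :=
  fun hcone7 => cone7_additiveGluing_of hcone7

end

end Summit.CriticalPhenomena.PercolationContinuityZ3.Theorems
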